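/-
HONEST FRAMING: certified error envelopes and provably optimal rounding/accumulation schemes for
low-precision formats under stated cost models; every table by two implementations; no hardware
or vendor claims.
-/
import Summits.Ventures.CertifiedArithmetic.LowPrec.OptDemotionGoodActive

/-!
# The demotion law (Theorem T8), part 6e: GOOD-ACTIVE IS FALSE (a kernel-checked counterexample)

OPTIMA.md §B T8(b)(iii″)(R9)(2) (opt seat, gen 11) conjectured GOOD-ACTIVE — "for every tree `t` and
every grid excess `x ∈ 2u·ℕ ∩ [0,1)` the envelope `G_t(x)` of the full line family is attained by a
good line (`α ≥ λ`)" — on the evidence of 73 280 grid evaluations over 11 241 node shapes with no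
exception, and handed it over as the single remaining single-tree input of Conjecture D.  Part 6d
proved Conjecture D for every class of trees on which it holds.

THIS FILE refutes the global statement: at `q = 5` (`u = 1/32`) the 43-leaf tree `gaCex43` has, at
the TOP grid excess `x = 15/16`, the envelope value `4257/16384 + (135/512)(15/16) = 8307/16384`
attained ONLY by the line `(α, λ) = (4257/16384, 135/512)` — BAD by `λ - α = 63/16384` — while every
good line of `L_t` stays strictly below (the best is `16611/32768`, short by `3/32768`).  Hence
`¬ GoodActiveTree 5 gaCex43` and `¬ GoodActive 5` (`decide +kernel` over the 5 896-line family; found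
by the lean seat's random search `work/conjC/`, which also finds a 77-leaf tree failing at `q = 4`,
`x = 7/8`; all failures seen sit at the top grid point `x = 1 - 2u`).

WHAT THIS DOES NOT REFUTE: Conjecture D, or the node step of the full-family invariant — at this tree
the exact node step holds with margin (`≥ 0.016·σ` at `x = 15/16`, exact enumeration in `work/conjC`),
and `M_t = 42761/32768 < 2` puts the tree inside part 5f's theorem anyway.  It refutes the PROOF
ARCHITECTURE "children present a good active line": the induction of part 6d needs a class hypothesis.
-/

namespace Summit.Ventures.CertifiedArithmetic.LowPrec.Opt

open Literature.ComputerArithmetic.JeannerodRump2018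
open Literature.ComputerArithmetic.JeannerodRump2018.SumTree

/-- Leaf (value irrelevant for the line family). -/
private def cL : SumTree := .leaf 0
/-- Node. -/
private def cN (a b : SumTree) : SumTree := .node a b

/-- THE COUNTEREXAMPLE TREE: 43 leaves, height 9, `M_t(1/32) = 42761/32768 ≈ 1.305`; in the bracket
notation of the cell's scripts
`(((((.((.(..))((..)((..).))))((.(.(..))).))(.(.(.(..)))))((((..)((..)((..).))).)(.(.(..)))))((.((.(.(.(..))))(((..).).)))(..)))`. -/
def gaCex43 : SumTree :=
  (cN (cN (cN (cN (cN cL (cN (cN cL (cN cL cL)) (cN (cN cL cL) (cN (cN cL cL) cL)))) (cN (cN cL (cN cL (cN cL cL))) cL))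
    (cN cL (cN cL (cN cL (cN cL cL))))) (cN (cN (cN (cN cL cL) (cN (cN cL cL) (cN (cN cL cL) cL))) cL) (cN cL (cN cL (cN cL cL)))))
    (cN (cN cL (cN (cN cL (cN cL (cN cL (cN cL cL)))) (cN (cN (cN cL cL) cL) cL))) (cN cL cL)))

/-- KERNEL FACTS at `u = 1/32`, `x = 15/16`: the bad line `(4257/16384, 135/512)` is a member of the
full family of `gaCex43`, and every GOOD member is strictly below it at `x = 15/16`
(`decide +kernel` over the 5 896 lines; about fifteen seconds). -/
theorem gaCex43_facts :
    ((4257 : ℚ) / 16384, (135 : ℚ) / 512) ∈ allLines (1 / 32) gaCex43 ∧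
    ∀ l' ∈ allLines (1 / 32) gaCex43, l'.2 ≤ l'.1 →
      l'.1 + l'.2 * ((15 : ℚ) / 16) < 4257 / 16384 + 135 / 512 * ((15 : ℚ) / 16) := by
  decide +kernel

/-- `u_5 = 1/32`. -/
theorem unitRoundoff_five : unitRoundoff 5 = 1 / 32 := by norm_num [unitRoundoff]

/-- **GOOD-ACTIVE FAILS for `gaCex43` at precision 5** (grid excess `x = 2·15·u_5 = 15/16`). -/
theorem not_goodActiveTree_gaCex43 : ¬ GoodActiveTree 5 gaCex43 := by
  intro h
  have hk : ((15 : ℕ) : ℚ) * (2 * unitRoundoff 5) < 1 := by rw [unitRoundoff_five]; norm_num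
  have hx : ((15 : ℕ) : ℚ) * (2 * unitRoundoff 5) = (15 : ℚ) / 16 := by
    rw [unitRoundoff_five]; norm_num
  obtain ⟨hmem, hdom⟩ := gaCex43_facts
  have h1 := h 15 hk
  rw [hx, unitRoundoff_five] at h1
  obtain ⟨l', hl', hgood, hle⟩ := h1 _ hmem
  have hlt := hdom l' hl' hgood
  dsimp only at hle
  linarith

/-- **`GoodActive 5` IS FALSE**: opt's GOOD-ACTIVE lemma (OPTIMA (iii″)(R9)(2)) fails at `q = 5`. -/
theorem not_goodActive_five : ¬ GoodActive 5 :=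
  fun h => not_goodActiveTree_gaCex43 ((goodActive_iff 5).mp h gaCex43)

/-- The badness is tiny and the tree is light: `λ - α = 63/16384`, the good envelope falls short by
`3/32768`, and `M_t(1/32) = 42761/32768 < 2` (so part 5f's theorem covers this tree). -/
theorem gaCex43_numbers :
    (135 : ℚ) / 512 - 4257 / 16384 = 63 / 16384 ∧
    (4257 : ℚ) / 16384 + 135 / 512 * (15 / 16) - 16611 / 32768 = 3 / 32768 ∧
    treeM (1 / 32) gaCex43 = 42761 / 32768 := by
  refine ⟨by norm_num, by norm_num, by decide +kernel⟩

end Summit.Ventures.CertifiedArithmetic.LowPrec.Opt
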